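import Summits.BirchSwinnertonDyer.Rank1Residual.X12.O11.RouteUTheoremU
import Summits.BirchSwinnertonDyer.Rank1Residual.X12.JZeroThreeUnitRegime
import Summits.BirchSwinnertonDyer.BirchSwinnertonDyer.Theorems.PrintCFramJZeroThreeTraceFormBadPrimes
import Summits.BirchSwinnertonDyer.BirchSwinnertonDyer.Theorems.PrintCFramJZeroThreeUnitRegimeKroneckerCharacters
import HarnessLib

/-! # K12r@3 — the TRIVIAL-CHARACTER twin of ROUTE U at `p = 3` (Kriz–Li Thm. 7.1, SECOND
# alternative `ψ = 1`, typed by ty1 as `KrizLi2019.thm71_padicLogHeegner_unit_of_trivialChar`,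
# p545985): BSD(W, 3) for every globally minimal `W ≅ y² = x³ + d·m²` with `d ∈ {1, −3}` (`d* = 1`),
# bad primes `⊂ {3}` (`N = 3^a`) and analytic rank one — class `243a` — modulo Route U's telescope and
# ONE new displayed certificate, Thm. 7.1's hypothesis (4) `ord₃(log₃ ᾱ) = 1` (cell `bsd-print-cfram`,
# seat p3 g2; regime T = `LocalThreeTorsionBSDThree`, stmt-BirchSwinnertonDyer-20699; PLAN v2 §2 p3)

HONEST FRAMING (cell `bsd-print-cfram`, run/shared/lean/pub/bsd-print-cfram/, D-0131 (2) print
tier; verbatim in every file of the cell): the cell works the partition leaf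
`CornerF ∧ p ramified in the CM field K` (LADDER-BSD row K7r = B13; W-ALL row 12r) in PARTITION
currency — a leaf or a cell counts only when its theorem is in the kernel BY NAME. Nothing here is a
Literature statement, no named fact is introduced, nothing is asserted about BSD; beyond-print: NO
(Kriz–Li 2019 Thm. 7.1 second alternative + Rem. 3.10 + Gross–Zagier–Kolyvagin, exactly bsd-cm's
T-U5 composition with the `ψ = 1` fact in place of Thm. 1.20; lit g3 / DOSSIER §24: on the whole
leaf this alternative reaches ONE rank-one class, `243a` = «x³ + y³ = 9», because hypothesis (3)
forces `N` to be a power of `3` for a `j = 0` curve).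

* §1 `bsdp_of_thm71_of_rem310` — **T-U5 with the trivial character, prime-generic**: `BSD(W, p)` for
  a globally minimal `W/ℚ` of analytic rank one at an odd prime `p ∣ N` with `|W̃^{ns}(𝔽_p)| = p`,
  from `hKL71 : thm71_padicLogHeegner_unit_of_trivialChar`, `hRem` (Rem. 3.10), T-U0
  (`O11.bsdp_of_heegnerIndexVal_eq_maninVal`) and T-U2 (`RouteU.heegnerIndexVal_eq_maninVal_of_rem310`)
  — the proof of `RouteU.bsdp_of_thm120_of_rem310` verbatim with the KL conclusion supplied by the
  `ψ = 1` fact; every binder displayed: Thm. 7.1's (1) trace form `a_ℓ ≡ 1 + ℓ`, (2) `p ∣ N`, (3) the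
  Steinberg clause, `d_K < −4`, `p` split, and (4) the `ᾱ`-certificate `(𝔭, α, τ, h𝔭, hιp, hα, hτ,
  hunit)`; T-U0/T-U2's data, PUB facts, twin, `htamW`/`hSW`/`hSd`, level-`0` generator.
* §2 **`bsdp_three_of_thm71_trivialChar`** — the `j = 0`, `p = 3` CLASS THEOREM SHAPE: for
  `C • W = y² = x³ + d·m²` with `d = 1 ∨ d = −3` (`dm²` sixth-power-free), bad primes `⊂ {3}`,
  `a₂(W) = 0`, `K` imaginary quadratic with `d_K < −4` and `3` split: (1) is DISCHARGED by the trace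
  form (`PrintCFram.hss_three_of_mordell_int` with `ψ = 1`, `J(1 | ℓ) = J(−3 | ℓ) = 1` at `ℓ ≡ 1 (3)`,
  and `ω(ℓ) ≡ ℓ`), (2) by `3 ∣ N` (`j = 0`), (3) vacuously (no bad `ℓ ≠ 3`), the Heegner hypothesis
  from `3` split, `hμ`/`hns`/`hp2` as in p4's `JZeroThree.bsdp_three_of_thm120_unitRegime`. What
  REMAINS displayed: Route U's telescope as in `PrintCFram.bsdp_three_of_unitRegime_five_eleven` and
  the (4)-certificate — a per-`K` two-engine numeric (e.g. `K = ℚ(√−2)`: `𝔭 = (1 + √−2)`, `h_K = 1`,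
  `ιp(1 − √−2) ≡ 5 (mod 9)`, `5² ≢ 1 (mod 9)` ⇒ `ord₃ log₃ = 1`), NOT decided here.
References: [KrizLi2019] Thm. 7.1 second alternative (pp. 42–43), Rem. 7.2, Lemma 7.4, §7.4 (28),
Lemma 7.7, Rem. 3.10 (p. 26); [GrossZagier1986] V.§2; [Miller2011LMS] Def. 1.1;
`X12/O11/RouteUTheoremU.lean` (bsd-cm T-U5), `X12/JZeroThreeUnitRegime.lean` (p4).
-/

set_option linter.dupNamespace false
set_option autoImplicit false

noncomputable section

open scoped Classical NumberTheorySymbols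
open NumberField Field WeierstrassCurve DirichletCharacter IsDedekindDomain
open Literature.NumberTheory.EllipticCurves Literature.NumberTheory.EllipticCurves.KrizLi2019
  Literature.NumberTheory.EllipticCurves.ModularForms Literature.NumberTheory.EllipticCurves.Rank1Residual
  Literature.NumberTheory.QuadraticFields
  Summit.BirchSwinnertonDyer.Rank1Residual.X12.O11 Summit.BirchSwinnertonDyer.Rank1Residual.X12.O11.RouteU

namespace Summit.BirchSwinnertonDyer.BirchSwinnertonDyer.Theorems.PrintCFram

/-! ## §1 T-U5 with Kriz–Li Thm. 7.1, second alternative (`ψ = 1`), prime-generic -/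

/-- **`BSD(W, p)` at an additive prime `p ∣ N` from Kriz–Li Thm. 7.1 (`ψ = 1`) ∧ Rem. 3.10,
Gross–Zagier–Kolyvagin and the descent inputs** — bsd-cm's T-U5 (`RouteU.bsdp_of_thm120_of_rem310`)
with the Kriz–Li conclusion `(|W̃^{ns}(𝔽_p)|/p)·log_{ω_W} P ≢ 0 (mod p)` supplied by the trivial-
character fact `hKL71`; every binder displayed (module docstring §1); `c ≠ 0` derived.
[cite: KrizLi2019, Thm. 7.1 second alternative (pp. 42–43), Rem. 3.10 (p. 26)]
[cite: GrossZagier1986, V.§2 (pp. 310–312)] [cite: Miller2011LMS, Def. 1.1] -/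
theorem bsdp_of_thm71_of_rem310
    (hKL71 : KrizLi2019.thm71_padicLogHeegner_unit_of_trivialChar)
    (hRem : KrizLi2019.rem310_padicLogHeegner_integral)
    (W : WeierstrassCurve ℚ) [W.IsElliptic] [W.IsGloballyMinimal] (p : ℕ) [Fact p.Prime]
    [NeZero (W.conductorNorm ℤ)] (K : Type) [Field K] [NumberField K]
    [NeZero (NumberField.discr K).natAbs]
    (D : ModularParametrizationData W (W.conductorNorm ℤ))
    (H : HeegnerDatum (W.conductorNorm ℤ) (NumberField.discr K)) (ι : K →+* ℂ) (ιp : K →+* ℚ_[p])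
    (P : (W.baseChange K).toAffine.Point)
    -- T-U0's displayed inputs
    (hGZ : gross_zagier (W.conductorNorm ℤ) W K) (hKo : kolyvagin (W.conductorNorm ℤ) W K)
    (hGZK : rank_eq_analyticRank_of_analyticRank_le_one) (hmod : hasEntireLFunction_rat)
    (hK : IsImaginaryQuadratic K) (hHN : SatisfiesHeegnerHypothesis (W.conductorNorm ℤ) K)
    (hP : WeierstrassCurve.Affine.Point.map ι.toRatAlgHom P = heegnerPointComplex D H)
    (hp2 : p ≠ 2) (hμ : ¬ p ∣ Units.torsionOrder K)
    (hr : W.analyticRank = 1)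
    (hLt : (W.quadraticTwist (NumberField.discr K : ℚ)).entireLFunction 1 ≠ 0)
    (Wd : WeierstrassCurve ℚ) [Wd.IsElliptic] [Wd.IsGloballyMinimal] (Cd : VariableChange ℚ)
    (hWd : Cd • W.quadraticTwist (NumberField.discr K : ℚ) = Wd)
    (htw : ∃ q : ℚ, Wd.entireLFunction 1 / (Wd.realPeriodRat : ℂ) = (q : ℂ) ∧
      padicValRat p q = (padicValNat p Wd.shaOrder : ℤ) + padicValNat p Wd.tamagawaProduct -
        2 * padicValNat p Wd.torsionOrder)
    (htam : padicValNat p Wd.tamagawaProduct = padicValNat p W.tamagawaProduct)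
    (hu : padicValRat p (Cd.u : ℚ) = 0)
    (htamW : ¬ p ∣ W.tamagawaProduct)
    (hSW : ∀ [Finite W.sha], ¬ p ∣ W.shaOrder) (hSd : ∀ [Finite Wd.sha], ¬ p ∣ Wd.shaOrder)
    -- Thm. 7.1 (second alternative)'s displayed inputs
    (hss1 : ∀ ℓ : ℕ, ℓ.Prime → ¬ (ℓ ∣ p * W.conductorNorm ℤ) →
      ‖((W.LFunction ℓ : ℤ) : ℚ_[p]) - (1 + (ℓ : ℚ_[p]))‖ < 1)
    (hpN : p ∣ W.conductorNorm ℤ)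
    (h3 : ∀ ℓ : ℕ, (hℓ : ℓ.Prime) → ℓ ∣ W.conductorNorm ℤ → ℓ ≠ p →
      ¬ (ℓ ^ 2 ∣ W.conductorNorm ℤ) ∧ ((ℓ : ZMod p) = -1 ∧ (ℓ : ZMod p) ≠ 1) ∧
        ¬ (haveI := Fact.mk hℓ; W.HasSplitMultiplicativeReductionAtPrime ℓ))
    (hd4 : NumberField.discr K < -4)
    (hsplit : ((Ideal.span {(p : ℤ)}).primesOver (𝓞 K)).ncard = 2)
    (𝔭 : Ideal (𝓞 K)) (α : 𝓞 K) (τ : K ≃ₐ[ℚ] K)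
    (h𝔭 : 𝔭 ∈ (Ideal.span {(p : ℤ)}).primesOver (𝓞 K)) (hιp : ∀ x : 𝓞 K, x ∈ 𝔭 → ‖ιp x‖ < 1)
    (hα : Ideal.span {α} = 𝔭 ^ NumberField.classNumber K) (hτ : τ ≠ 1)
    (hunit : ‖((p : ℚ_[p]) - 1) / (2 * p) * padicLog p (ιp (τ (α : K)))‖ = 1)
    -- T-U2's displayed inputs
    (hns : KrizLi2019.nsPointCount W p = p)
    [Finite (AddCommGroup.torsion (W.baseChange K).toAffine.Point)]
    (crd : (W.baseChange K).toAffine.Point →+ ℤ) (g : (W.baseChange K).toAffine.Point)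
    (hg : crd g = 1) (hker : ∀ x, crd x = 0 → IsOfFinAddOrder x)
    (hiv : ∀ x : (W.baseChange K).toAffine.Point, p • x = 0 → x = 0)
    (hg0 : ‖Castella2018.padicLogOmega W p ιp g‖ = 1) :
    BSDp W p := by
  -- the conclusion of Thm. 7.1 (ψ = 1) at this Heegner point, and the unit statement (with Rem. 3.10)
  have hne := hKL71 p hp2 W hss1 hpN h3 D K hK hd4 hHN hsplit H ι ιp P hP 𝔭 α τ h𝔭 hιp hα hτ hunit
  have hc0 : D.c ≠ 0 :=
    (KrizLi2019.padicLogOrd_eq_of_norm_eq_one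
      (KrizLi2019.norm_eq_one_of_rem310 hRem D hK hHN hsplit H ι ιp hP hne)).2.1
  exact bsdp_of_heegnerIndexVal_eq_maninVal W p (W.conductorNorm ℤ) K D H ι P hGZ hKo hGZK hmod hK hHN
    hP hp2 hc0 hμ hr hLt Wd Cd hWd htw htam hu
    (heegnerIndexVal_eq_maninVal_of_rem310 hRem W p D hK hHN hsplit H ι ιp P hP hne
      hns crd g hg hker hiv hg0)
    htamW hSW hSd

/-! ## §2 The `j = 0`, `p = 3` class-theorem shape (class `243a`) -/

/-- **The trivial-character trace form at `3` for a `j = 0` curve with `d* = 1`**: if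
`C • W = y² = x³ + d·m²` with `d ∈ {1, −3}` (`dm²` sixth-power-free) and `a₂(W) = 0` when `W` is good
at `2`, then `‖a_ℓ(W) − (1 + ℓ)‖₃ < 1` at every prime `ℓ ∤ 3N` (`a_ℓ ≡ J(d | ℓ)(ℓ + 1) ≡ 1 + ℓ (mod 3)`:
at `ℓ ≡ 1 (3)` `J(1 | ℓ) = J(−3 | ℓ) = 1`, at `ℓ ≡ 2 (3)` both sides vanish). Hypothesis (1) of
Thm. 7.1's second alternative. [cite: KrizLi2019, Thm. 7.1 (p. 42 L33–35) and §10.1] -/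
theorem traceForm_trivial_three_of_mordell (W : WeierstrassCurve ℚ) [W.IsElliptic] [W.IsGloballyMinimal]
    {d m : ℤ} (hd : d = 1 ∨ d = -3) (hm : m ≠ 0)
    (hW : ∃ C : VariableChange ℚ, C • W = mordellCurve ((d : ℚ) * (m : ℚ) ^ 2))
    (h6 : ∀ ℓ : ℕ, ℓ.Prime → ¬ ((ℓ : ℤ) ^ 6 ∣ d * m ^ 2))
    (h2 : (haveI : Fact (Nat.Prime 2) := ⟨Nat.prime_two⟩; W.HasGoodReductionAtPrime 2) →
      W.LFunction 2 = 0)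
    (ω : DirichletCharacter ℚ_[3] 3) (hω : IsTeichmullerCharacter ω) :
    ∀ ℓ : ℕ, ℓ.Prime → ¬ (ℓ ∣ 3 * W.conductorNorm ℤ) →
      ‖((W.LFunction ℓ : ℤ) : ℚ_[3]) - (1 + (ℓ : ℚ_[3]))‖ < 1 := by
  haveI : Fact (Nat.Prime 3) := ⟨Nat.prime_three⟩
  have hsf : Squarefree d := by
    rcases hd with rfl | rfl <;> rw [← Int.squarefree_natAbs]
    · show Squarefree (1 : ℕ); exact squarefree_one
    · show Squarefree (3 : ℕ); exact Nat.prime_three.squarefree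
  -- `hss` with the trivial character `ψ = 1` of level `1`
  have hss := hss_three_of_mordell_int W hsf hm hW h6 h2 (1 : DirichletCharacter ℚ_[3] 1) ω hω
    (mul_one 1) (fun ℓ hℓ _ hℓ1 => by
      have hodd : Odd ℓ := hℓ.odd_of_ne_two (by omega)
      rw [MulChar.one_apply (isUnit_of_subsingleton _)]
      rcases hd with rfl | rfl
      · rw [jacobiSym.one_left]; norm_num
      · rw [(jacobiSym_neg_three_of_mod_three_eq_one hodd hℓ1).2]; norm_num)
  intro ℓ hℓ hℓN
  have h := hss ℓ hℓ hℓN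
  rw [inv_one, MulChar.one_apply (isUnit_of_subsingleton _), one_mul] at h
  -- `ω(ℓ) ≡ ℓ (mod 3)`
  have hℓ3 : ¬ ((3 : ℤ) ∣ (ℓ : ℤ)) := by
    intro h3
    have h33 : ℓ = 3 :=
      ((Nat.prime_dvd_prime_iff_eq Nat.prime_three hℓ).mp (by exact_mod_cast h3)).symm
    subst h33
    exact hℓN (dvd_mul_right 3 _)
  have hωℓ := hω (ℓ : ℤ) hℓ3
  rw [Int.cast_natCast, Int.cast_natCast] at hωℓ
  calc ‖((W.LFunction ℓ : ℤ) : ℚ_[3]) - (1 + (ℓ : ℚ_[3]))‖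
      = ‖(((W.LFunction ℓ : ℤ) : ℚ_[3]) - (1 + ω (ℓ : ZMod 3))) + (ω (ℓ : ZMod 3) - (ℓ : ℚ_[3]))‖ := by
        ring_nf
    _ ≤ max ‖((W.LFunction ℓ : ℤ) : ℚ_[3]) - (1 + ω (ℓ : ZMod 3))‖ ‖ω (ℓ : ZMod 3) - (ℓ : ℚ_[3])‖ :=
        Padic.nonarchimedean _ _
    _ < 1 := max_lt h hωℓ

/-- **BSD(W, 3) from Kriz–Li Thm. 7.1 (`ψ = 1`) for a `j = 0` curve of `3`-power conductor** (class
`243a`) — for every globally minimal `W/ℚ` of analytic rank one with `C • W = y² = x³ + d·m²`,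
`d ∈ {1, −3}`, `dm²` sixth-power-free, bad primes `⊂ {3}`, `a₂(W) = 0`, and an imaginary quadratic `K`
with `d_K < −4` in which `3` splits: §1 with hypotheses (1) (trace form, `traceForm_trivial_three_of_mordell`),
(2) (`3 ∣ N`), (3) (vacuous), the Heegner hypothesis, `hμ`, `hns` DISCHARGED; displayed: Route U's data,
PUB facts, twin, certificates, level-`0` generator, and Thm. 7.1's (4)-certificate `(𝔭, α, τ, …, hunit)`.
[cite: KrizLi2019, Thm. 7.1 second alternative (pp. 42–43), Rem. 7.2 (p. 43), Rem. 3.10 (p. 26)]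
[cite: GrossZagier1986, V.§2 (pp. 310–312)] [cite: Miller2011LMS, Def. 1.1] -/
theorem bsdp_three_of_thm71_trivialChar
    (hKL71 : KrizLi2019.thm71_padicLogHeegner_unit_of_trivialChar)
    (hRem : KrizLi2019.rem310_padicLogHeegner_integral)
    (W : WeierstrassCurve ℚ) [W.IsElliptic] [W.IsGloballyMinimal] [NeZero (W.conductorNorm ℤ)]
    -- the Mordell datum (`d* = 1`) and the per-curve one-liners
    {d m : ℤ} (hd : d = 1 ∨ d = -3) (hm : m ≠ 0)
    (hW : ∃ C : VariableChange ℚ, C • W = mordellCurve ((d : ℚ) * (m : ℚ) ^ 2))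
    (h6 : ∀ ℓ : ℕ, ℓ.Prime → ¬ ((ℓ : ℤ) ^ 6 ∣ d * m ^ 2))
    (h2 : (haveI : Fact (Nat.Prime 2) := ⟨Nat.prime_two⟩; W.HasGoodReductionAtPrime 2) →
      W.LFunction 2 = 0)
    (hS : ∀ ℓ : ℕ, (hℓ : ℓ.Prime) → ¬ (haveI := Fact.mk hℓ; W.HasGoodReductionAtPrime ℓ) → ℓ = 3)
    -- the Heegner field and Route U's data / PUB facts
    (K : Type) [Field K] [NumberField K] [NeZero (NumberField.discr K).natAbs]
    (hK : IsImaginaryQuadratic K) (hd4 : NumberField.discr K < -4)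
    (hsplit : ((Ideal.span {((3 : ℕ) : ℤ)}).primesOver (𝓞 K)).ncard = 2)
    (D : ModularParametrizationData W (W.conductorNorm ℤ))
    (H : HeegnerDatum (W.conductorNorm ℤ) (NumberField.discr K)) (ι : K →+* ℂ)
    (ιp : K →+* ℚ_[3]) (P : (W.baseChange K).toAffine.Point)
    (hGZ : gross_zagier (W.conductorNorm ℤ) W K) (hKo : kolyvagin (W.conductorNorm ℤ) W K)
    (hGZK : rank_eq_analyticRank_of_analyticRank_le_one) (hmod : hasEntireLFunction_rat)
    (hP : WeierstrassCurve.Affine.Point.map ι.toRatAlgHom P = heegnerPointComplex D H)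
    (hr : W.analyticRank = 1)
    (hLt : (W.quadraticTwist (NumberField.discr K : ℚ)).entireLFunction 1 ≠ 0)
    (Wd : WeierstrassCurve ℚ) [Wd.IsElliptic] [Wd.IsGloballyMinimal] (Cd : VariableChange ℚ)
    (hWd : Cd • W.quadraticTwist (NumberField.discr K : ℚ) = Wd)
    (htw : ∃ q : ℚ, Wd.entireLFunction 1 / (Wd.realPeriodRat : ℂ) = (q : ℂ) ∧
      padicValRat 3 q = (padicValNat 3 Wd.shaOrder : ℤ) + padicValNat 3 Wd.tamagawaProduct -
        2 * padicValNat 3 Wd.torsionOrder)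
    (htam : padicValNat 3 Wd.tamagawaProduct = padicValNat 3 W.tamagawaProduct)
    (hu : padicValRat 3 (Cd.u : ℚ) = 0)
    (htamW : ¬ 3 ∣ W.tamagawaProduct)
    (hSW : ∀ [Finite W.sha], ¬ 3 ∣ W.shaOrder) (hSd : ∀ [Finite Wd.sha], ¬ 3 ∣ Wd.shaOrder)
    -- Thm. 7.1 (4): the `ᾱ`-certificate, displayed
    (𝔭 : Ideal (𝓞 K)) (α : 𝓞 K) (τ : K ≃ₐ[ℚ] K)
    (h𝔭 : 𝔭 ∈ (Ideal.span {((3 : ℕ) : ℤ)}).primesOver (𝓞 K)) (hιp : ∀ x : 𝓞 K, x ∈ 𝔭 → ‖ιp x‖ < 1)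
    (hα : Ideal.span {α} = 𝔭 ^ NumberField.classNumber K) (hτ : τ ≠ 1)
    (hunit : ‖(((3 : ℕ) : ℚ_[3]) - 1) / (2 * (3 : ℕ)) * padicLog 3 (ιp (τ (α : K)))‖ = 1)
    -- a Teichmüller character mod 3 and T-U2's level-0 generator data
    (ω : DirichletCharacter ℚ_[3] 3) (hω : KrizLi2019.IsTeichmullerCharacter ω)
    [Finite (AddCommGroup.torsion (W.baseChange K).toAffine.Point)]
    (crd : (W.baseChange K).toAffine.Point →+ ℤ) (g : (W.baseChange K).toAffine.Point)
    (hg : crd g = 1) (hker : ∀ x, crd x = 0 → IsOfFinAddOrder x)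
    (hiv : ∀ x : (W.baseChange K).toAffine.Point, 3 • x = 0 → x = 0)
    (hg0 : ‖Castella2018.padicLogOmega W 3 ιp g‖ = 1) :
    BSDp W 3 := by
  haveI : Fact (Nat.Prime 3) := ⟨Nat.prime_three⟩
  -- `j(W) = 0`
  have hj : W.j = 0 := by
    obtain ⟨C, hC⟩ := hW
    have hc4 : (C • W).c₄ = 0 := by rw [hC, mordellCurve_c₄]
    have h1' : (C • W).j = W.j := variableChange_j W C
    have h2' : (C • W).j = 0 := by rw [WeierstrassCurve.j, hc4]; simp
    rw [← h1', h2']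
  -- (2): `3 ∣ N`
  have hpN : 3 ∣ W.conductorNorm ℤ :=
    (W.dvd_conductorNorm_iff_not_hasGoodReductionAtPrime 3).mpr
      (Rank1Residual.X12.JZeroThree.not_good_three_of_j_eq_zero W hj)
  -- the Heegner hypothesis: the only bad prime is `3`, which splits
  have hHN : SatisfiesHeegnerHypothesis (W.conductorNorm ℤ) K := by
    intro q hq hqN
    haveI := Fact.mk hq
    have hbad : ¬ W.HasGoodReductionAtPrime q := fun hgood =>
      not_dvd_conductorNorm_of_hasGoodReductionAtPrime W hgood hqN
    rw [hS q hq hbad]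
    exact hsplit
  refine bsdp_of_thm71_of_rem310 hKL71 hRem W 3 K D H ι ιp P hGZ hKo hGZK hmod hK hHN hP (by norm_num)
    (Rank1Residual.X12.JZeroThree.not_three_dvd_torsionOrder hK hd4) hr hLt Wd Cd hWd htw htam hu
    htamW hSW hSd (traceForm_trivial_three_of_mordell W hd hm hW h6 h2 ω hω) hpN
    (fun ℓ hℓ hℓN hℓ3 => ?_) hd4 hsplit 𝔭 α τ h𝔭 hιp hα hτ hunit
    (Rank1Residual.X12.JZeroThree.nsPointCount_three_of_j_eq_zero W hj) crd g hg hker hiv hg0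
  -- (3) is vacuous: a prime `ℓ ∣ N` is bad, hence `ℓ = 3`
  haveI := Fact.mk hℓ
  exact absurd (hS ℓ hℓ ((W.dvd_conductorNorm_iff_not_hasGoodReductionAtPrime ℓ).mp hℓN)) hℓ3

end Summit.BirchSwinnertonDyer.BirchSwinnertonDyer.Theorems.PrintCFram

end
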